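import Literature.NumberTheory.GaloisRepresentations.HomDualIdeleReadoutSExt
import Literature.NumberTheory.GaloisRepresentations.LocalTatePairingBidualTransport
import HarnessLib

/-!
# The `S`-readout of the `Ext` road READ ON `M`: `R_v := -H¹(κ_v) ∘ readoutSExt` on `Ext¹_{C_{G_S}}((M^D)^{N_S}, I_S)`, its values,
# vanishing off `S`, and (R3) (Milne *ADT* I Lemma 4.13, Thm. 4.10 (a); Harari Prop. 17.26)

Topic `NumberTheory/GaloisRepresentations`; namespace `Literature.NumberTheory.GaloisRepresentations.HomDual`.  One definition WITH BODY
(`readoutSExtB`) and theorems; no named fact, no instance, no notation, no `sorry`.  Sequel to bsd-eis -w6 g11's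
`HomDualIdeleReadoutSExt.lean` (`readoutSExt ρ₀ n S hur hM v : Ext¹(⟨M₀^{N_S}⟩, I_S) →+ H¹(K_v, M₀^D)` for the PRESENTED module `M₀`, (R3)
`exists_forall_mem_readoutSExt_eq`) and `LocalTatePairingBidualTransport.lean` (`H¹(κ) ∘ H¹(ι) = id`).

THE POINT.  The kit of lane «PT-Ш-S-TC» (-w2 g11, `ShaExtRoadKit.natural_at_of_kit'`) presents `A = ⟨(M^D)^{N_S}⟩`, i.e. the PRESENTED
module is `M₀ := M^D = ρ.tateDual n`, so -w6's readout lands in `H¹(K_v, M₀^D) = H¹(K_v, M^{DD})`, while the kit's datum `R n M ρ v` is valued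
in `H¹(K_v, M)` and paired by `localTatePairingZMod ρ n v`.  **`readoutSExtB ρ n S hur hn v := -(H¹(κ_v) ∘ readoutSExt (ρ.tateDual n) n S hur _ v)`**
(`κ = bidualInv ρ n hn : M^{DD} → M`, -w2's canonical inverse biduality) is that datum; the SIGN is door-c5's convention `nat = -Φ⁻¹ ∘ H¹(κ)`
of the tree's all-places reciprocity law moved from the bridge onto the readout, so that (R4)_S holds with the layer bridge `nat_S`
itself (`RestrictedRamificationExtOneLayerNat.natLayerS`).  Recorded: `readoutSExtB_bdryS` (value on `δ_S[f]`),
`readoutSExtB_inr_eq_zero_of_not_mem` (zero at finite `v ∉ S`), and **(R3) `exists_forall_mem_readoutSExtB_eq`** — VERBATIM the binder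
`hR3` of the kit' with `R := readoutSExtB` (from -w6's (R3) at the family `v ↦ -H¹(ι_v)(t v)`).

HONEST FRAMING: plumbing; no duality statement and no case of BSD is proved here.
AI formalisation, weaker than expert review; established only by the kernel check.

## References
* J. S. Milne, *Arithmetic Duality Theorems*, 2nd ed. (2006), I Lemma 4.13, I Thm. 4.10 (a) (proof, p. 58), I §0 Prop. 0.19. [MilneADT2006]
* D. Harari, *Galois Cohomology and Class Field Theory* (2020), Prop. 17.26 (proof), Lemma 17.23. [Harari2020]
-/

noncomputable section

open NumberField IsDedekindDomain CategoryTheory CategoryTheory.Abelian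
open Field (absoluteGaloisGroup)
open Literature.NumberTheory.Automorphic Literature.Algebra.Homology Literature.Algebra.Homology.DiscreteRep
open scoped Classical ContRepresentation

namespace Literature.NumberTheory.GaloisRepresentations

namespace HomDual

open IdeleClassBar IdeleReadout FreePresentation DiscreteGaloisModule

variable {K : Type} [Field K] [NumberField K]
variable {M : Type} [AddCommGroup M] [TopologicalSpace M] [DiscreteTopology M] [Finite M]
variable (ρ : DiscreteGaloisModule K M) (n : ℕ) [NeZero n] [Finite (TateDual K M n)]
variable (S : Finset (HeightOneSpectrum (𝓞 K)))
  (hur : ramificationSubgroup K (↑S : Set (HeightOneSpectrum (𝓞 K))) ≤ ContinuousRep.ker (ρ.tateDual n))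
  (hn : ∀ m : M, n • m = 0)

/-- **The `S`-readout read on `M`**: `R_v := -H¹(κ_v) ∘ readoutSExt (ρ.tateDual n) n S hur _ v :
Ext¹_{C_{G_S}}(⟨(M^D)^{N_S}⟩, I_S) →+ H¹(K_v, M)` (`κ = bidualInv ρ n hn : M^{DD} → M`; the sign is door-c5's `nat = -Φ⁻¹ ∘ H¹(κ)`
convention moved onto the readout). [cite: MilneADT2006, I Thm. 4.10 (a) (proof, p. 58), Lemma 4.13][cite: Harari2020, Prop. 17.26] -/
def readoutSExtB (v : Place K) :
    Ext (presentationComplexS (ρ.tateDual n) (↑S : Set (HeightOneSpectrum (𝓞 K)))).X₃ (truncIdeleBarD K S) 1 →+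
      galoisCohomology (ρ.toLocal v) 1 :=
  -((galoisCohomology.map ((bidualInv ρ n hn).restrictField (Place.Completion v)) 1).comp
    (readoutSExt (ρ.tateDual n) n S hur (nsmul_tateDual_eq_zero_of_nsmul n n hn) v))

/-- Unfolding. [cite: MilneADT2006, I Thm. 4.10 (a) (proof, p. 58)] -/
theorem readoutSExtB_apply (v : Place K)
    (e : Ext (presentationComplexS (ρ.tateDual n) (↑S : Set (HeightOneSpectrum (𝓞 K)))).X₃ (truncIdeleBarD K S) 1) :
    readoutSExtB ρ n S hur hn v e =
      -(galoisCohomology.map ((bidualInv ρ n hn).restrictField (Place.Completion v)) 1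
        (readoutSExt (ρ.tateDual n) n S hur (nsmul_tateDual_eq_zero_of_nsmul n n hn) v e)) := rfl

/-- **Value on a boundary class**: `R_v (δ_S[f]) = -H¹(κ_v) (readoutS (ρ.tateDual n) … v f)` (= `-H¹(κ_v)` of door-c6's idèle readout of
`presSharp f` at `v`). [cite: MilneADT2006, I Thm. 4.10 (a) (proof, p. 58)] -/
theorem readoutSExtB_bdryS (v : Place K)
    (f : (presentationComplexS (ρ.tateDual n) (↑S : Set (HeightOneSpectrum (𝓞 K)))).X₁ ⟶ truncIdeleBarD K S) :
    readoutSExtB ρ n S hur hn v (bdrySHom (ρ.tateDual n) S hur f) =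
      -(galoisCohomology.map ((bidualInv ρ n hn).restrictField (Place.Completion v)) 1
        (readoutS (ρ.tateDual n) n S hur (nsmul_tateDual_eq_zero_of_nsmul n n hn) v f)) := by
  rw [readoutSExtB_apply, readoutSExt_bdryS]

/-- **`R_v = 0` at a finite place `v ∉ S`.** [cite: Harari2020, Lemma 15.39, Prop. 17.26] -/
theorem readoutSExtB_inr_eq_zero_of_not_mem {v : HeightOneSpectrum (𝓞 K)} (hv : v ∉ S)
    (e : Ext (presentationComplexS (ρ.tateDual n) (↑S : Set (HeightOneSpectrum (𝓞 K)))).X₃ (truncIdeleBarD K S) 1) :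
    readoutSExtB ρ n S hur hn (Sum.inr v) e = 0 := by
  rw [readoutSExtB_apply, readoutSExt_inr_eq_zero_of_not_mem _ _ _ _ _ hv]
  exact (congrArg Neg.neg (map_zero _)).trans neg_zero

/-- **(R3) for `R_v`**: every family of local classes `(t_v)_{v ∈ Sig} ∈ ∏ H¹(K_v, M)` is `(R_v e)_{v ∈ Sig}` for one `e`, `Sig = S ∪ Ω_∞` — VERBATIM
the binder `hR3` of the lane's kit' with `R := readoutSExtB`.  (From -w6 g11's (R3) for `readoutSExt` at the family `v ↦ H¹(ι_v)(-t_v)`, and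
`H¹(κ_v) ∘ H¹(ι_v) = id`.) [cite: MilneADT2006, I Thm. 4.10 (a) (proof, p. 58), Lemma 4.13][cite: Harari2020, Prop. 17.26] -/
theorem exists_forall_mem_readoutSExtB_eq (Sig : Finset (Place K))
    (hSig₂ : ∀ v : HeightOneSpectrum (𝓞 K), (Sum.inr v : Place K) ∈ Sig ↔ v ∈ S)
    (t : Π v : Place K, galoisCohomology (ρ.toLocal v) 1) :
    ∃ e : Ext (presentationComplexS (ρ.tateDual n) (↑S : Set (HeightOneSpectrum (𝓞 K)))).X₃ (truncIdeleBarD K S) 1,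
      ∀ v ∈ Sig, readoutSExtB ρ n S hur hn v e = t v := by
  obtain ⟨e, he⟩ := exists_forall_mem_readoutSExt_eq (ρ.tateDual n) n S hur (nsmul_tateDual_eq_zero_of_nsmul n n hn) Sig hSig₂
    fun v => galoisCohomology.map ((bidual ρ n).restrictField (Place.Completion v)) 1 (-t v)
  refine ⟨e, fun v hv => ?_⟩
  rw [readoutSExtB_apply, he v hv, map_restrictField_bidualInv_bidual]
  exact neg_neg _

end HomDual

end Literature.NumberTheory.GaloisRepresentations

end
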